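import Literature.AlgebraicGeometry.Morphisms.FlatClosedSubschemeEqOfFibres
import HarnessLib

/-!
# A flat closed subscheme read on ONE fibre, affine base: the ring core at one prime and a good affine chart through a point

Topic `Literature/AlgebraicGeometry/Morphisms`, namespace `Literature.AlgebraicGeometry.Morphisms`. THEOREMS only (no
definition, no instance, no notation, no named fact); universe-polymorphic `Scheme.{u}`; generic. Sequel of ★
`Morphisms/FlatClosedSubschemeEqOfFibres` («a flat closed subscheme is determined by its fibres», hypothesis on ALL fibres): here the
hypothesis is read on ONE fibre and the conclusion holds on an affine neighbourhood of each point of that fibre — the local statement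
behind Görtz–Wedhorn I, Lemma 14.21 / Prop. 14.28 («isomorphy of flat proper schemes is detected on fibres»), completed in
`Morphisms/FlatClosedSubschemeEqNearFibre` (spreading by a closed map) and `Morphisms/IsoOfFibreIsoFlatProper` (Prop. 14.28).

THE PRINT. Matsumura, *Commutative ring theory*, Thm. 22.5 ((2) ⇒ (1) for `u : B⧸I → B⧸J` at ONE prime) and Görtz–Wedhorn I,
Lemma 14.21: for `A → B`, ideals `I ≤ J` of `B` with `J` finitely generated and `B⧸J` flat over `A`, and a prime `q` of `B` over
`𝔭 ⊆ A` with `J·(κ(𝔭) ⊗_A B) ≤ I·(κ(𝔭) ⊗_A B)`: `Tor₁^A(B⧸J, κ(𝔭)) = 0` gives `κ(𝔭) ⊗_A (J⧸I) ↪ κ(𝔭) ⊗_A (B⧸I)` with image `0`,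
so `κ(q) ⊗ (J⧸I) = 0` and, `J⧸I` being finite, `(J⧸I)_r = 0` for some `r ∉ q` (Nakayama: `Supp = V(Ann)`).

WHAT IS HERE.
* §1 `Ideal.exists_notMem_forall_mul_mem_of_flat_quotient_of_fibre` — the ring core AT ONE PRIME (`∃ r ∉ q, r • J ≤ I`; the per-prime
  block of ★ `Ideal.eq_of_le_of_flat_quotient_of_fibres`).
* §2 `IdealSheafData.map_includeRight_le_of_isPullback_at` (chart step at one prime: the fibre-square inequality `J_Y ≤ I_Y` read on the
  chart ring `κ(𝔭) ⊗_A Γ(X, W)`, ★ `Morphisms.fibreChartIso`), `under_comap_val_primeIdealOf_eq` (the prime of `A` below the chart prime of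
  a point `x ∈ W` is `F(x)`), and `IdealSheafData.exists_mem_ideal_eq_of_flat_of_isPullback_at`: for `F : X → Spec A`, `I ≤ J` with `J` of
  finite type and `V(J)` flat over `A`, if `J_Y ≤ I_Y` on the fibre squares over the field points AT `F(x)`, then `I(V) = J(V)` on an affine
  open `V ∋ x` (a basic open `D(r)` of any affine chart at `x`).

Consumer: cell `hodgecm-mathlib` FLOOR 0 ∕ P1, sub-line F-4 (`stub_II`, [MFK94] Prop. 6.16 Hom-schemes), brick (B2)(ii) «the iso-locus of a
flat proper family is open». HC_CM is proved only modulo the 7 printed citations until rung 0 closes — nothing here bears on a summit statement.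

## References
* [Matsumura1987] H. Matsumura, *Commutative Ring Theory* (1986/87), Theorem 22.5.
* [GortzWedhorn2020] U. Görtz, T. Wedhorn, *Algebraic Geometry I: Schemes*, 2nd ed. (2020), Prop. 4.20 (p. 104), Example 4.36 (p. 112),
  Lemma 14.21, Proposition 14.28 (p. 554).
* [StacksProject] The Stacks Project, Tags 00HL, 00L2.
-/

noncomputable section

-- `TopCat.Presheaf` is not reducible (as in Mathlib's `AlgebraicGeometry/Modules` and ★ `Morphisms/FibreChartRing`).
set_option backward.isDefEq.respectTransparency false

open CategoryTheory CategoryTheory.Limits AlgebraicGeometry TopologicalSpace Opposite TensorProduct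

universe u

namespace Literature.AlgebraicGeometry.Morphisms

/-! ## §1 The ring core at one prime -/

section RingCore

variable {A B : Type*} [CommRing A] [CommRing B] [Algebra A B]

/-- **Ring core at one prime.** Let `A → B`, `I ≤ J` ideals of `B` with `J` finitely generated and `B ⧸ J` flat over `A`, and let
`q` be a prime of `B` with `𝔭 = q ∩ A`. If the extensions of `J` and `I` to the fibre ring `κ(𝔭) ⊗_A B` satisfy `J^e ≤ I^e`, then
`r • J ≤ I` for some `r ∉ q` — i.e. `I = J` on the basic open `D(r) ∋ q`. (Tor₁-vanishing: `κ(𝔭) ⊗_A (J⧸I) ↪ κ(𝔭) ⊗_A (B⧸I)` has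
image zero, so `κ(𝔭) ⊗_A (J⧸I) = 0`, hence `κ(q) ⊗_B (J⧸I) = 0`, i.e. `q ∉ Supp(J⧸I) = V(Ann(J⧸I))` by Nakayama, `J⧸I` being finite.)
[cite: Matsumura1987, Theorem 22.5] [cite: GortzWedhorn2020, Lemma 14.21] [cite: StacksProject, Tag 00HL] -/
theorem Ideal.exists_notMem_forall_mul_mem_of_flat_quotient_of_fibre
    {I J : Ideal B} (hIJ : I ≤ J) (hJ : J.FG) [Module.Flat A (B ⧸ J)] (q : PrimeSpectrum B)
    (h : J.map (Algebra.TensorProduct.includeRight :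
        B →ₐ[A] (q.asIdeal.under A).ResidueField ⊗[A] B) ≤
      I.map (Algebra.TensorProduct.includeRight :
        B →ₐ[A] (q.asIdeal.under A).ResidueField ⊗[A] B)) :
    ∃ r ∉ q.asIdeal, ∀ j ∈ J, r * j ∈ I := by
  classical
  -- the factor map `π : B ⧸ I → B ⧸ J` and its kernel `M = J ⧸ I`
  let π : (B ⧸ I) →ₐ[B] (B ⧸ J) := Ideal.Quotient.factorₐ B hIJ
  have hπs : Function.Surjective π := Ideal.Quotient.factor_surjective hIJ
  let M : Submodule B (B ⧸ I) := LinearMap.ker π.toLinearMap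
  have hM : M = Submodule.map I.mkQ J := by
    apply le_antisymm
    · intro x hx
      obtain ⟨b, rfl⟩ := Ideal.Quotient.mk_surjective x
      have hb : Ideal.Quotient.mk J b = 0 := hx
      exact ⟨b, Ideal.Quotient.eq_zero_iff_mem.mp hb, rfl⟩
    · rintro x ⟨b, hb, rfl⟩
      change π (Ideal.Quotient.mk I b) = 0
      exact Ideal.Quotient.eq_zero_iff_mem.mpr hb
  haveI : Module.Finite B M := Module.Finite.iff_fg.mpr (hM ▸ Submodule.FG.map (f := I.mkQ) (N := J) hJ)
  -- `q ∉ Supp(M)`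
  have hq : q ∉ Module.support B M := by
    intro hq
    rw [Module.mem_support_iff_nontrivial_residueField_tensorProduct] at hq
    revert hq
    rw [imp_false, not_nontrivial_iff_subsingleton]
    -- the fields `K = κ(𝔭)`, `𝔭 = q ∩ A`, and `L = κ(q)`
    let K := (q.asIdeal.under A).ResidueField
    let L := q.asIdeal.ResidueField
    -- Step 1: `K ⊗[A] M = 0`
    have hK : ∀ z : K ⊗[A] M, z = 0 := by
      let πA : (B ⧸ I) →ₗ[A] (B ⧸ J) := π.toLinearMap.restrictScalars A
      let ιA : M →ₗ[A] (B ⧸ I) := M.subtype.restrictScalars A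
      have hex : Function.Exact ιA πA := LinearMap.exact_subtype_ker_map π.toLinearMap
      have hinj : Function.Injective (ιA.lTensor K) :=
        LinearMap.lTensor_injective_of_exact_of_flat πA hπs ιA Subtype.val_injective hex K
      intro z
      apply hinj
      rw [map_zero]
      have hw0 : πA.lTensor K (ιA.lTensor K z) = 0 := by
        rw [← LinearMap.comp_apply, ← LinearMap.lTensor_comp]
        have : πA ∘ₗ ιA = 0 := by
          ext m
          exact m.2
        rw [this, LinearMap.lTensor_zero, LinearMap.zero_apply]
      let mkI : B →ₗ[A] (B ⧸ I) := (Ideal.Quotient.mkₐ A I).toLinearMap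
      let mkJ : B →ₗ[A] (B ⧸ J) := (Ideal.Quotient.mkₐ A J).toLinearMap
      obtain ⟨w, hw'⟩ := LinearMap.lTensor_surjective K (g := mkI)
        (fun x => Ideal.Quotient.mkₐ_surjective A I x) (ιA.lTensor K z)
      rw [← hw'] at hw0 ⊢
      have hcomp : πA ∘ₗ mkI = mkJ := by
        ext b
        rfl
      have hw : mkJ.lTensor K w = 0 := by
        rw [← hcomp, LinearMap.lTensor_comp, LinearMap.comp_apply]
        exact hw0
      have hkerJ : w ∈ RingHom.ker (Algebra.TensorProduct.map (AlgHom.id A K) (Ideal.Quotient.mkₐ A J)) := hw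
      have hkI : RingHom.ker (Ideal.Quotient.mkₐ A I) = I := Ideal.mk_ker
      have hkJ : RingHom.ker (Ideal.Quotient.mkₐ A J) = J := Ideal.mk_ker
      have hkerI : w ∈ RingHom.ker (Algebra.TensorProduct.map (AlgHom.id A K) (Ideal.Quotient.mkₐ A I)) := by
        rw [Algebra.TensorProduct.lTensor_ker _ (Ideal.Quotient.mkₐ_surjective A _), hkJ] at hkerJ
        rw [Algebra.TensorProduct.lTensor_ker _ (Ideal.Quotient.mkₐ_surjective A _), hkI]
        exact h hkerJ
      exact hkerI
    -- Step 2: `L ⊗[A] M = 0` by base change along `κ(𝔭) → κ(q)`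
    letI : Algebra K L :=
      (Ideal.ResidueField.map (q.asIdeal.under A) q.asIdeal (algebraMap A B) rfl).toAlgebra
    haveI : IsScalarTower A K L := IsScalarTower.of_algebraMap_eq fun a => by
      rw [RingHom.algebraMap_toAlgebra, Ideal.ResidueField.map_algebraMap,
        ← IsScalarTower.algebraMap_apply]
    have hL : ∀ z : L ⊗[A] M, z = 0 := by
      intro z
      let e := (TensorProduct.AlgebraTensorModule.cancelBaseChange A K L L M).symm
      apply e.injective
      rw [map_zero]
      induction e z using TensorProduct.induction_on with
      | zero => rfl
      | tmul l n => rw [hK n, TensorProduct.tmul_zero]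
      | add x y hx hy => rw [hx, hy, add_zero]
    -- Step 3: `L ⊗[B] M` is a quotient of `L ⊗[A] M`
    refine ⟨fun x y => ?_⟩
    obtain ⟨x, rfl⟩ := TensorProduct.mapOfCompatibleSMul_surjective B A A L M x
    obtain ⟨y, rfl⟩ := TensorProduct.mapOfCompatibleSMul_surjective B A A L M y
    rw [hL x, hL y]
  -- `Supp(M) = V(Ann M)` (`M` finite): some `r ∈ Ann(M)` avoids `q`
  rw [Module.mem_support_iff_of_finite] at hq
  obtain ⟨r, hr, hrq⟩ := SetLike.not_le_iff_exists.mp hq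
  refine ⟨r, hrq, fun j hj => ?_⟩
  have hm : Ideal.Quotient.mk I j ∈ M := by
    change π (Ideal.Quotient.mk I j) = 0
    exact Ideal.Quotient.eq_zero_iff_mem.mpr hj
  have h0 : r • (⟨Ideal.Quotient.mk I j, hm⟩ : M) = 0 := Module.mem_annihilator.mp hr _
  have h1 : r • Ideal.Quotient.mk I j = 0 := congrArg Subtype.val h0
  have h2 : Ideal.Quotient.mk I (r * j) = 0 := by
    rw [map_mul]
    exact h1
  exact Ideal.Quotient.eq_zero_iff_mem.mp h2

end RingCore

/-! ## §2 The chart step at one prime and a good affine chart through a point (affine base) -/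

section ChartAtPrime

variable {A : Type u} [CommRing A] {X : Scheme.{u}} (F : X ⟶ Spec (.of A)) {I J : X.IdealSheafData}

/-- **Chart step at one prime.** For `F : X → Spec A`, an affine `W ⊆ X` with `B = Γ(X, W)` and a prime `q` of `B` over `𝔭 ⊆ A`: if on
SOME (equivalently every) fibre square `Y = X ×_A κ(𝔭)` the pulled-back ideal sheaves satisfy `J_Y ≤ I_Y`, then
`J(W)·(κ(𝔭) ⊗_A B) ≤ I(W)·(κ(𝔭) ⊗_A B)` (affine chart `Γ(Y, W_Y) = κ(𝔭) ⊗_A B`, ★ `Morphisms.fibreChartIso`, and the chart formula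
★ `Limits.ideal_comap_preimage`) — the one-prime form of ★ `IdealSheafData.map_includeRight_le_of_isPullback`.
[cite: GortzWedhorn2020, Prop. 4.20 (p. 104) and Example 4.36 (p. 112)] -/
theorem IdealSheafData.map_includeRight_le_of_isPullback_at
    {W : X.Opens} (hW : IsAffineOpen W) (q : PrimeSpectrum (ChartRing F W))
    (hsq : ∀ ⦃Y : Scheme.{u}⦄ (g : Y ⟶ X) (y : Y ⟶ Spec (.of (q.asIdeal.under A).ResidueField)),
      IsPullback g y F (Spec.map (CommRingCat.ofHom (algebraMap A (q.asIdeal.under A).ResidueField))) →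
        J.comap g ≤ I.comap g) :
    ((J.ideal ⟨W, hW⟩).map (ChartRing.mk F W)).map
        (Algebra.TensorProduct.includeRight :
          ChartRing F W →ₐ[A] (q.asIdeal.under A).ResidueField ⊗[A] ChartRing F W) ≤
      ((I.ideal ⟨W, hW⟩).map (ChartRing.mk F W)).map
        (Algebra.TensorProduct.includeRight :
          ChartRing F W →ₐ[A] (q.asIdeal.under A).ResidueField ⊗[A] ChartRing F W) := by
  let K := (q.asIdeal.under A).ResidueField
  let s : Spec (.of K) ⟶ Spec (.of A) := Spec.map (CommRingCat.ofHom (algebraMap A K))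
  let g := pullback.fst F s
  let y := pullback.snd F s
  have hP : IsPullback g y F s := IsPullback.of_hasPullback F s
  have hW' : IsAffineOpen (g ⁻¹ᵁ W) := isAffineOpen_preimage_of_isPullback F g y hP hW
  -- the fibre inequality on the chosen square, read on the chart `g⁻¹W`
  have hle' := Scheme.IdealSheafData.le_def.mp (hsq g y hP) ⟨g ⁻¹ᵁ W, hW'⟩
  rw [Limits.ideal_comap_preimage g J ⟨W, hW⟩ hW', Limits.ideal_comap_preimage g I ⟨W, hW⟩ hW'] at hle'
  -- transport along the fibre chart isomorphism `K ⊗[A] B ≅ Γ(Y, g⁻¹W)`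
  let e := fibreChartIso F g y hP hW
  have hcomp : (e.toRingHom.comp (Algebra.TensorProduct.includeRight :
      ChartRing F W →ₐ[A] K ⊗[A] ChartRing F W).toRingHom).comp (ChartRing.mk F W) = (g.app W).hom := by
    ext b
    change e (1 ⊗ₜ[A] ChartRing.mk F W b) = g.app W b
    rw [fibreChartIso_one_tmul]
    rfl
  have key : ∀ L : Ideal Γ(X, W), ((L.map (ChartRing.mk F W)).map
      (Algebra.TensorProduct.includeRight : ChartRing F W →ₐ[A] K ⊗[A] ChartRing F W).toRingHom).map
        e.toRingHom = L.map (g.app W).hom := by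
    intro L
    rw [Ideal.map_map, Ideal.map_map, hcomp]
  rw [← key (J.ideal ⟨W, hW⟩), ← key (I.ideal ⟨W, hW⟩)] at hle'
  have hbij : Function.Bijective e.toRingHom := e.bijective
  have := Ideal.comap_mono (f := e.toRingHom) hle'
  rwa [Ideal.comap_map_of_bijective e.toRingHom hbij, Ideal.comap_map_of_bijective e.toRingHom hbij] at this

/-- **The point below a chart prime.** For `F : X → Spec A`, an affine open `W ⊆ X` and `x ∈ W`: the prime of `A` under the prime
`primeIdealOf x` of the chart ring `Γ(X, W)` (an `A`-algebra through `F^♯`) is the point `F(x)` — because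
`Spec Γ(X, W) → X → Spec A` is `Spec` of the structure map (Mathlib `IsAffineOpen.SpecMap_appLE_fromSpec`).
[cite: GortzWedhorn2020, §(3.2) and Prop. 3.4] -/
theorem under_comap_val_primeIdealOf_eq {W : X.Opens} (hW : IsAffineOpen W) (x : W) :
    ((hW.primeIdealOf x).asIdeal.comap (ChartRing.val (f := F) (W := W))).under A = (F.base x.1).asIdeal := by
  -- `Spec Γ(X, W) → X → Spec A` is `Spec (A → Γ(X, W))`
  have hc : hW.fromSpec ≫ F = Spec.map ((Scheme.ΓSpecIso (.of A)).inv ≫ F.appLE ⊤ W le_top) := by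
    rw [Spec.map_comp, ← Scheme.isoSpec_Spec_inv, ← IsAffineOpen.fromSpec_top]
    exact (IsAffineOpen.SpecMap_appLE_fromSpec F (isAffineOpen_top _) hW le_top).symm
  have hpt : F.base x.1 = (Spec.map ((Scheme.ΓSpecIso (.of A)).inv ≫ F.appLE ⊤ W le_top)).base (hW.primeIdealOf x) := by
    rw [← hc, Scheme.Hom.comp_apply, IsAffineOpen.fromSpec_primeIdealOf]
  rw [hpt]
  -- both sides are `comap` of the prime along `A → Γ(X, W)`
  rw [Ideal.under_def, Ideal.comap_comap]
  rfl

variable (hIJ : I ≤ J)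

include hIJ in
/-- **Affine base, pointwise.** For `F : X → Spec A`, `I ≤ J` ideal sheaves on `X` with `J` of finite type and `V(J) → Spec A` flat,
and a point `x ∈ X`: if on every fibre square `Y = X ×_A Spec K` over a field point of `Spec A` AT `F(x)` one has `J_Y ≤ I_Y`, then
`I(V) = J(V)` on some affine open `V ∋ x` — namely a basic open `D(r) ⊆ W` of any affine `W ∋ x`, with `r ∉ 𝔮_x` from the ring core
§1 at the prime `𝔮_x` of `Γ(X, W)`. [cite: GortzWedhorn2020, Lemma 14.21] [cite: Matsumura1987, Theorem 22.5] -/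
theorem IdealSheafData.exists_mem_ideal_eq_of_flat_of_isPullback_at (hJ : ∀ U : X.affineOpens, (J.ideal U).FG)
    [Flat (J.subschemeι ≫ F)] (x : X)
    (hfib : ∀ ⦃K : Type u⦄ [Field K] (xK : Spec (.of K) ⟶ Spec (.of A)),
      xK.base (IsLocalRing.closedPoint K) = F.base x →
      ∀ ⦃Y : Scheme.{u}⦄ (g : Y ⟶ X) (y : Y ⟶ Spec (.of K)), IsPullback g y F xK → J.comap g ≤ I.comap g) :
    ∃ V : X.affineOpens, x ∈ (V : X.Opens) ∧ I.ideal V = J.ideal V := by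
  classical
  -- an affine chart `W ∋ x`, its chart ring `B = Γ(X, W)` and the prime `q` of `x`
  obtain ⟨W, hW, hxW, -⟩ := exists_isAffineOpen_mem_and_subset (X := X) (x := x) (U := ⊤) trivial
  let q₀ : PrimeSpectrum Γ(X, W) := hW.primeIdealOf ⟨x, hxW⟩
  let q : PrimeSpectrum (ChartRing F W) := PrimeSpectrum.comap (ChartRing.val (f := F) (W := W)) q₀
  have hq : q.asIdeal = q₀.asIdeal.comap (ChartRing.val (f := F) (W := W)) := rfl
  -- the fibre hypothesis at the prime `q ∩ A = F(x)`
  have hunder : q.asIdeal.under A = (F.base x).asIdeal := by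
    rw [hq]; exact under_comap_val_primeIdealOf_eq F hW ⟨x, hxW⟩
  let K := (q.asIdeal.under A).ResidueField
  have hxK : (Spec.map (CommRingCat.ofHom (algebraMap A K))).base (IsLocalRing.closedPoint K) = F.base x := by
    apply PrimeSpectrum.ext
    rw [← hunder]
    change ((PrimeSpectrum.comap (algebraMap A K)) (IsLocalRing.closedPoint K)).asIdeal = _
    rw [PrimeSpectrum.comap_asIdeal]
    change (IsLocalRing.maximalIdeal K).comap (algebraMap A K) = _
    rw [IsLocalRing.maximalIdeal_eq_bot, ← RingHom.ker_eq_comap_bot, Ideal.ker_algebraMap_residueField]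
  -- §1 at `q`: `r • J(W) ≤ I(W)` for some `r ∉ q`
  haveI := flat_chartRing_quotient F J hW
  have hfg : ((J.ideal ⟨W, hW⟩).map (ChartRing.mk F W)).FG := Ideal.FG.map (hJ _) _
  have hle : (I.ideal ⟨W, hW⟩).map (ChartRing.mk F W) ≤ (J.ideal ⟨W, hW⟩).map (ChartRing.mk F W) :=
    Ideal.map_mono (Scheme.IdealSheafData.le_def.mp hIJ _)
  obtain ⟨r, hrq, hr⟩ := Ideal.exists_notMem_forall_mul_mem_of_flat_quotient_of_fibre (A := A) hle hfg q
    (IdealSheafData.map_includeRight_le_of_isPullback_at F hW q (fun Y g y hP => hfib _ hxK g y hP))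
  -- read `r` in `Γ(X, W)` and pass to the basic open `D(r)`
  let r₀ : Γ(X, W) := ChartRing.val r
  have hmkbij : Function.Bijective (ChartRing.mk F W) := ⟨fun a b h => h, fun b => ⟨b, rfl⟩⟩
  have hr₀ : ∀ j ∈ J.ideal ⟨W, hW⟩, r₀ * j ∈ I.ideal ⟨W, hW⟩ := by
    intro j hj
    have h1 : r * ChartRing.mk F W j ∈ (I.ideal ⟨W, hW⟩).map (ChartRing.mk F W) :=
      hr _ (Ideal.mem_map_of_mem _ hj)
    have h2 : r₀ * j ∈ ((I.ideal ⟨W, hW⟩).map (ChartRing.mk F W)).comap (ChartRing.mk F W) :=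
      Ideal.mem_comap.mpr h1
    rwa [Ideal.comap_map_of_bijective _ hmkbij] at h2
  have hxr : x ∈ X.basicOpen r₀ := by
    have h1 : (hW.primeIdealOf ⟨x, hxW⟩) ∈ (PrimeSpectrum.basicOpen r₀ : Set (PrimeSpectrum Γ(X, W))) :=
      (PrimeSpectrum.mem_basicOpen _ _).mpr hrq
    rw [← hW.fromSpec_preimage_basicOpen] at h1
    have h2 : hW.fromSpec.base (hW.primeIdealOf ⟨x, hxW⟩) ∈ X.basicOpen r₀ := h1
    rwa [IsAffineOpen.fromSpec_primeIdealOf] at h2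
  refine ⟨X.affineBasicOpen (U := ⟨W, hW⟩) r₀, hxr, le_antisymm (Scheme.IdealSheafData.le_def.mp hIJ _) ?_⟩
  -- `J(D(r)) = J(W)·Γ(D(r)) ≤ I(W)·Γ(D(r)) = I(D(r))`, as `r` is a unit on `D(r)`
  rw [← J.map_ideal_basicOpen ⟨W, hW⟩ r₀, ← I.map_ideal_basicOpen ⟨W, hW⟩ r₀, Ideal.map_le_iff_le_comap]
  intro j hj
  have hu : IsUnit ((X.presheaf.map (homOfLE <| X.basicOpen_le r₀).op).hom r₀) := by
    haveI := hW.isLocalization_basicOpen r₀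
    exact IsLocalization.Away.algebraMap_isUnit (S := Γ(X, X.basicOpen r₀)) r₀
  rw [Ideal.mem_comap]
  have hmem : (X.presheaf.map (homOfLE <| X.basicOpen_le r₀).op).hom (r₀ * j) ∈
      (I.ideal ⟨W, hW⟩).map (X.presheaf.map (homOfLE <| X.basicOpen_le r₀).op).hom :=
    Ideal.mem_map_of_mem _ (hr₀ j hj)
  rw [map_mul] at hmem
  exact (Ideal.unit_mul_mem_iff_mem _ hu).mp hmem

end ChartAtPrime

end Literature.AlgebraicGeometry.Morphisms

end
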